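import Summits.AtomisticToContinuum.HydrodynamicLimit.Theorems.LambertianContactSwapLambertianEulerLiouville
import Summits.AtomisticToContinuum.HydrodynamicLimit.Theorems.LambertianContactSwapLambertianEulerTailsZero
import HarnessLib

/-!
# `LambertianEuler` (stmt-AtomisticToContinuum-11854), line `Sketch`: the floor of TL1G-Λ —
# Gaussian `L¹` velocity tails of the Lambertian gas at global equilibrium, all times, all `N`

Registered sub-goal `gaussianVelocityTails_equilibrium` (S1 of lead c9) of the research input
TL1G-Λ (`…KineticInputs.GaussianVelocityTailsLambda`) of the skeleton
`Cruxes/LambertianEuler/Lines/Sketch.lean`: for CONSTANT profiles `(b, w, ϑ)` (`b, ϑ > 0`) and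
`0 < σ < 1/2`, the cubic-weighted tail functional of the peculiar velocities along the Lambertian
hard-sphere flow `Λ_s` started from the Gibbs law `G_N = localGibbsLaw σ b w ϑ N Φ` and driven by
the Lambertian noise `γ^ℕ`,

  `E_{G_N ⊗ γ^ℕ} ∑ᵢ 𝟙{‖vᵢ(s) − u(xᵢ(s))‖ > V} (1 + ‖vᵢ(s)‖)³ ≤ A e^{−a V²} (N + 1)`

for every `V ≥ 1`, every `N`, every flow `Φ`, every field `u` with `‖u‖ ≤ W` and every `s ≥ 0`,
with `A, a > 0` depending only on `(b, w, ϑ, σ, W)`.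

## Proof

The Gibbs law with constant profiles is `Λ`-invariant in law,
`(G_N ⊗ γ^ℕ) ∘ Λ_s⁻¹ = G_N` (`…Liouville.gibbsInvarianceLambda_holds`), so the time-`s`
expectation of any nonnegative measurable observable equals its time-`0` expectation; at time `0`
the one-body Gaussian exponential moment `E_{G_N} e^{a‖vᵢ‖²} ≤ K` holds uniformly in `N`, `Φ`
and `i` (`…TailsZero.tailsZero_exists_lintegral_exp_gaussMeasure_le`,
`…TailsZero.tailsZero_lintegral_exp_localGibbsLaw_le`).  The pointwise domination
`𝟙{‖v − u‖ > V} (1 + ‖v‖)³ ≤ e^{(a/2)(t² + W²)} e^{−(a/4)V²} e^{a‖v‖²}` (`a t = 3`; from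
`1 + r ≤ eʳ`, `3r ≤ (a/2)(r² + t²)` and `V ≤ ‖v‖ + W`), uniform in the arbitrary field `u`
with `‖u‖ ≤ W`, reduces the claim to that moment: the Bochner integral is bounded by the lower
Lebesgue integral of the dominating measurable function (`norm_integral_le_lintegral_norm`, no
measurability of `u` needed), which is transported to time `0` by `lintegral_map` and the
invariance.

References: H. Spohn, *Large Scale Dynamics of Interacting Particles* (1991), Part I §2.3;
C. Cercignani, R. Illner, M. Pulvirenti, *The Mathematical Theory of Dilute Gases* (1994), §4.2.
-/

noncomputable section

namespace Summit.AtomisticToContinuum.HydrodynamicLimit.Theorems.LambertianContactSwapLambertianEulerGaussianTailsEquilibrium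

open scoped BigOperators Topology ENNReal InnerProductSpace
open MeasureTheory ProbabilityTheory Filter Set InformationTheory
open Literature.MathematicalPhysics.KineticTheory
open Literature.Analysis.FluidPDE Literature.Analysis.FluidPDE.Alexander

/-! ## The pointwise domination of the cubic-weighted tail indicator -/

/-- **Gaussian domination of the cubic-weighted peculiar-velocity tail indicator.**  For `a > 0`,
`a t = 3`, `V ≥ 0` and `‖u‖ ≤ W`:
`𝟙{V < ‖v − u‖} (1 + ‖v‖)³ ≤ e^{(a/2)t² + (a/2)W²} · e^{−(a/4)V²} · e^{a‖v‖²}` — from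
`(1 + r)³ ≤ e^{3r}` (`Real.add_one_le_exp`), `3r ≤ (a/2)r² + (a/2)t²` (a square) and
`V ≤ ‖v‖ + W`, `V² ≤ 2‖v‖² + 2W²`. [folklore] -/
theorem cubeTailIndicator_le_exp {a t W V : ℝ} (ha : 0 < a) (ht : a * t = 3) (hV : 0 ≤ V)
    {v u : V3} (hu : ‖u‖ ≤ W) :
    (if V < ‖v - u‖ then (1 + ‖v‖) ^ 3 else 0) ≤
      Real.exp (a / 2 * t ^ 2 + a / 2 * W ^ 2) * Real.exp (-(a / 4 * V ^ 2)) *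
        Real.exp (a * ‖v‖ ^ 2) := by
  split_ifs with h
  · have hr : 0 ≤ ‖v‖ := norm_nonneg v
    have hVle : V ≤ ‖v‖ + W := by
      have h' := norm_sub_le v u
      linarith
    have h1 : (1 + ‖v‖) ^ 3 ≤ Real.exp (3 * ‖v‖) := by
      have h0 : 1 + ‖v‖ ≤ Real.exp ‖v‖ := by linarith [Real.add_one_le_exp ‖v‖]
      calc (1 + ‖v‖) ^ 3 ≤ (Real.exp ‖v‖) ^ 3 := pow_le_pow_left₀ (by positivity) h0 3
        _ = Real.exp (3 * ‖v‖) := by rw [← Real.exp_nat_mul]; norm_num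
    rw [← Real.exp_add, ← Real.exp_add]
    refine h1.trans (Real.exp_le_exp.2 ?_)
    have h3r : a * t * ‖v‖ = 3 * ‖v‖ := by rw [ht]
    have hW : 0 ≤ W := (norm_nonneg u).trans hu
    have hV2 : V ^ 2 ≤ 2 * ‖v‖ ^ 2 + 2 * W ^ 2 := by nlinarith [sq_nonneg (‖v‖ - W)]
    have hV2' := mul_le_mul_of_nonneg_left hV2 ha.le
    nlinarith [mul_nonneg ha.le (sq_nonneg (‖v‖ - t)), h3r, hV2']
  · positivity

/-! ## The registered sub-goal -/

/-- **TL1G-Λ at global equilibrium, all times, all `N` (floor of the research input).**  For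
constant profiles `b, ϑ > 0`, `w`, reduced diameter `0 < σ < 1/2` and a velocity-field bound
`W ≥ 0` there are `A, a > 0` such that for every `V ≥ 1`, every `N`, every hard-sphere flow `Φ`,
every field `u` with `‖u‖ ≤ W` and every `s ≥ 0`,
`E_{G_N ⊗ γ^ℕ} ∑ᵢ 𝟙{V < ‖vᵢ(Λ_s) − u(xᵢ(Λ_s))‖} (1 + ‖vᵢ(Λ_s)‖)³ ≤ A e^{−aV²} (N + 1)`:
`Λ`-invariance in law of the Gibbs law with constant profiles (`gibbsInvarianceLambda_holds`)
transports the dominating Gaussian moment (`cubeTailIndicator_le_exp`) to time `0`, where the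
one-body bound `E_{G_N} e^{a‖vᵢ‖²} ≤ K` is uniform in `N`, `Φ`, `i`
(`tailsZero_lintegral_exp_localGibbsLaw_le`). [folklore] -/
theorem gaussianVelocityTails_equilibrium :
    ∀ (b ϑ : ℝ) (w : V3), 0 < b → 0 < ϑ → ∀ σ : ℝ, 0 < σ → σ < 2⁻¹ → ∀ W : ℝ, 0 ≤ W →
      ∃ A a : ℝ, 0 < A ∧ 0 < a ∧ ∀ V : ℝ, 1 ≤ V →
        ∀ (N : ℕ) (Φ : HardSphereFlow (Torus.geometry (Fin 3)) (hsDiameter σ N) (N + 1)) (uf : T3 → V3),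
          (∀ x, ‖uf x‖ ≤ W) → ∀ s : ℝ, 0 ≤ s →
          ∫ p, (∑ i : Fin (N + 1),
              if V < ‖(lambertFlow (Torus.geometry (Fin 3)) (hsDiameter σ N) p.2 p.1 s i).2 -
                  uf (lambertFlow (Torus.geometry (Fin 3)) (hsDiameter σ N) p.2 p.1 s i).1‖ then
                (1 + ‖(lambertFlow (Torus.geometry (Fin 3)) (hsDiameter σ N) p.2 p.1 s i).2‖) ^ 3 else 0)
            ∂((localGibbsLaw σ (fun _ => b) (fun _ => w) (fun _ => ϑ) N Φ).prod (lambertNoise (Fin 3))) ≤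
          A * Real.exp (-(a * V ^ 2)) * ((N : ℝ) + 1) := by
  intro b ϑ w hb hϑ σ hσ hσ' W hW
  have hσ2 : σ ≤ 1 / 2 := by rw [one_div]; exact hσ'.le
  -- the one-body Gaussian exponential moment of the Maxwellian `N(w, ϑ id)`
  obtain ⟨a, ha, K, hK⟩ :=
    LambertianContactSwapLambertianEulerTailsZero.tailsZero_exists_lintegral_exp_gaussMeasure_le
      (θ₀ := fun _ : T3 => ϑ) (u₀ := fun _ : T3 => w) continuous_const continuous_const
      (fun _ => hϑ)
  have hK' : ∀ x : T3, ∫⁻ v, ENNReal.ofReal (Real.exp (a * ‖v‖ ^ 2))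
      ∂gaussMeasure ((fun _ : T3 => w) x) ((fun _ : T3 => ϑ) x) ≤ ENNReal.ofReal (max K 1) :=
    fun x => (hK x).trans (ENNReal.ofReal_le_ofReal (le_max_left K 1))
  have hK1 : 0 < max K 1 := lt_max_of_lt_right one_pos
  -- the constant of the pointwise domination
  have ht : a * (3 / a) = 3 := by field_simp
  refine ⟨Real.exp (a / 2 * (3 / a) ^ 2 + a / 2 * W ^ 2) * max K 1, a / 4, by positivity,
    by positivity, ?_⟩
  intro V hV N Φ uf huf s hs
  -- abbreviations
  set A₀ : ℝ := Real.exp (a / 2 * (3 / a) ^ 2 + a / 2 * W ^ 2) with hA₀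
  set G := localGibbsLaw σ (fun _ => b) (fun _ => w) (fun _ => ϑ) N Φ with hG
  set μ := G.prod (lambertNoise (Fin 3)) with hμ
  set Λ : Config (N + 1) (Fin 3) T3 × (ℕ → V3) → Config (N + 1) (Fin 3) T3 :=
    fun p => lambertFlow (Torus.geometry (Fin 3)) (hsDiameter σ N) p.2 p.1 s with hΛ
  set F : Config (N + 1) (Fin 3) T3 × (ℕ → V3) → ℝ := fun p => ∑ i : Fin (N + 1),
    (if V < ‖(Λ p i).2 - uf (Λ p i).1‖ then (1 + ‖(Λ p i).2‖) ^ 3 else 0) with hF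
  show ∫ p, F p ∂μ ≤ A₀ * max K 1 * Real.exp (-(a / 4 * V ^ 2)) * ((N : ℝ) + 1)
  -- ingredients: invariance in law, measurability, the time-zero moment
  have hinv : μ.map Λ = G :=
    LambertianContactSwapLambertianEulerLiouville.gibbsInvarianceLambda_holds σ hσ hσ' N b ϑ w hb
      hϑ Φ s hs
  have hΛm : Measurable Λ := measurable_lambertFlow_hsDiameter hσ.le hσ' N s
  have hmi : ∀ i : Fin (N + 1), Measurable fun z : Config (N + 1) (Fin 3) T3 =>
      ENNReal.ofReal (Real.exp (a * ‖(z i).2‖ ^ 2)) := fun i =>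
    (Real.measurable_exp.comp ((measurable_norm.pow_const 2).const_mul a)).ennreal_ofReal.comp
      (measurable_pi_apply i).snd
  have hGi : ∀ i : Fin (N + 1),
      ∫⁻ z, ENNReal.ofReal (Real.exp (a * ‖(z i).2‖ ^ 2)) ∂G ≤ ENNReal.ofReal (max K 1) :=
    fun i => LambertianContactSwapLambertianEulerTailsZero.tailsZero_lintegral_exp_localGibbsLaw_le
      (a₀ := fun _ : T3 => b) (θ₀ := fun _ : T3 => ϑ) (u₀ := fun _ : T3 => w) continuous_const
      continuous_const continuous_const (fun _ => hb) (fun _ => hϑ) hK' hσ2 N Φ i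
  have hc : 0 < A₀ * Real.exp (-(a / 4 * V ^ 2)) := by positivity
  have hF0 : ∀ p, 0 ≤ F p := fun p => Finset.sum_nonneg fun i _ => by positivity
  -- the main estimate, in `ℝ≥0∞`
  have hmain : ∫⁻ p, ENNReal.ofReal ‖F p‖ ∂μ ≤
      ENNReal.ofReal (A₀ * Real.exp (-(a / 4 * V ^ 2)) * max K 1 * ((N : ℝ) + 1)) := by
    calc ∫⁻ p, ENNReal.ofReal ‖F p‖ ∂μ
        ≤ ∫⁻ p, (∑ i : Fin (N + 1), ENNReal.ofReal (A₀ * Real.exp (-(a / 4 * V ^ 2))) *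
            ENNReal.ofReal (Real.exp (a * ‖(Λ p i).2‖ ^ 2))) ∂μ := by
          refine lintegral_mono fun p => ?_
          rw [Real.norm_of_nonneg (hF0 p)]
          calc ENNReal.ofReal (F p)
              ≤ ENNReal.ofReal (∑ i : Fin (N + 1), A₀ * Real.exp (-(a / 4 * V ^ 2)) *
                  Real.exp (a * ‖(Λ p i).2‖ ^ 2)) :=
                ENNReal.ofReal_le_ofReal (Finset.sum_le_sum fun i _ =>
                  cubeTailIndicator_le_exp ha ht (zero_le_one.trans hV) (huf (Λ p i).1))
            _ = ∑ i : Fin (N + 1), ENNReal.ofReal (A₀ * Real.exp (-(a / 4 * V ^ 2))) *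
                  ENNReal.ofReal (Real.exp (a * ‖(Λ p i).2‖ ^ 2)) := by
                rw [ENNReal.ofReal_sum_of_nonneg fun i _ => by positivity]
                exact Finset.sum_congr rfl fun i _ => ENNReal.ofReal_mul hc.le
      _ = ∫⁻ z, (∑ i : Fin (N + 1), ENNReal.ofReal (A₀ * Real.exp (-(a / 4 * V ^ 2))) *
            ENNReal.ofReal (Real.exp (a * ‖(z i).2‖ ^ 2))) ∂(μ.map Λ) :=
          (lintegral_map (Finset.measurable_sum _ fun i _ => (hmi i).const_mul _) hΛm).symm
      _ = ∑ i : Fin (N + 1), ENNReal.ofReal (A₀ * Real.exp (-(a / 4 * V ^ 2))) *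
            ∫⁻ z, ENNReal.ofReal (Real.exp (a * ‖(z i).2‖ ^ 2)) ∂G := by
          rw [hinv, lintegral_finsetSum _ fun i _ => (hmi i).const_mul _]
          exact Finset.sum_congr rfl fun i _ => lintegral_const_mul _ (hmi i)
      _ ≤ ∑ _i : Fin (N + 1), ENNReal.ofReal (A₀ * Real.exp (-(a / 4 * V ^ 2))) *
            ENNReal.ofReal (max K 1) := by
          gcongr with i
          exact hGi i
      _ = ENNReal.ofReal (A₀ * Real.exp (-(a / 4 * V ^ 2)) * max K 1 * ((N : ℝ) + 1)) := by
          rw [Finset.sum_const, Finset.card_univ, Fintype.card_fin, nsmul_eq_mul,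
            ENNReal.ofReal_mul (by positivity : 0 ≤ A₀ * Real.exp (-(a / 4 * V ^ 2)) * max K 1),
            ENNReal.ofReal_mul hc.le, ENNReal.ofReal_add (Nat.cast_nonneg N) zero_le_one,
            ENNReal.ofReal_natCast, ENNReal.ofReal_one]
          push_cast
          ring
  -- conclusion
  calc ∫ p, F p ∂μ ≤ ‖∫ p, F p ∂μ‖ := Real.le_norm_self _
    _ ≤ (∫⁻ p, ENNReal.ofReal ‖F p‖ ∂μ).toReal := norm_integral_le_lintegral_norm F
    _ ≤ A₀ * Real.exp (-(a / 4 * V ^ 2)) * max K 1 * ((N : ℝ) + 1) :=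
        ENNReal.toReal_le_of_le_ofReal (by positivity) hmain
    _ = A₀ * max K 1 * Real.exp (-(a / 4 * V ^ 2)) * ((N : ℝ) + 1) := by ring

end Summit.AtomisticToContinuum.HydrodynamicLimit.Theorems.LambertianContactSwapLambertianEulerGaussianTailsEquilibrium

end
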